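import Literature.MathematicalPhysics.QuantumFieldTheory.QCDOS
import Literature.MathematicalPhysics.QuantumFieldTheory.OSLorentzInvariance
import HarnessLib

/-!
# `QCDBoostCovariance` — the crux-strategist's SPLIT (support for stmt-QuantumFields-9909)

Crux `stmt-QuantumFields-9909` (`TransparentRPWall.QCDBoostCovariance`, sub `QCD`, route
`route-QuantumFields-TransparentRPWall`): for every `N_f`, every lattice-QCD scheme `sch` and every
labelled Schwinger family `S` over the species `QCDField N_f` carrying the package `W` (E0, E0', E2, E3,
E4, translation and proper-hypercubic invariance on `⁰𝒮`; asymptotic scaling, physical branch and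
convergence of honest lattice QCD along `sch` to `S`; continuum and uniform lattice gap), reflection
positivity in the eight planar frames and the labelled planar spectral cone imply invariance of EVERY
species string on `⁰𝒮` under the rotations of the `(x₀,x₁)`-plane.

The model-blind core of the crux is FALSE (the `W(B₄)`-symmetric anisotropic generalised free field
with sixteen-mirror RP, a gap and the cone; GaierYngvason2000) — every proof must use the lattice tie
inside `W`.  This file records WHERE: the labelled twin of the architecture of the sibling crux
`MirrorModularBoosts.CurvatureBoostCovariance` (stmt-QuantumFields-9663, YangMills; line
`boosts-inherit-mirrors`, composition `CurvatureBoostCovariance_of` / `sieve_of_stubs`, thirteen landed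
stub files `Theorems/MirrorModularBoostsCurvatureBoostCovariance*.lean`).  Two pieces — what the LATTICE
must supply, and the MODEL-BLIND analysis that consumes it:

* `X₁` = **QCDSieveInputs** (USES THE TIE; the two places where the lattice enters the sibling line,
  `stub_tieRegularity` and `stub_levelGrowth`, labelled): `W` + eight frames + cone ⇒
  (i) STEP 0 — every species string `𝔖ₙᵏ|⁰𝒮` is integration against a function (the labelled
  `NPointRegular`; kills the junk families), AND (ii) LEVEL GROWTH — at OS level `a`, given planar
  invariance of all strings of degree `≤ 2a − 2`, the diagonal doubled pencil of a degree-`a` string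
  `ΘF* ⊗ F` (labels `rev k ++ k`) whose orbit function is a trigonometric polynomial `Σ p_j e^(4ijθ)`
  has no layer `|j| ≥ 2` ("one squeezed pair of composite-field insertions costs at most its dimension,
  softened"; level `1` = a two-point UV bound for every species of dimension `< 5`; `a ≥ 2` the bet).
* `X₂` = **LabelledBoostSieve** (MODEL-BLIND, any label type): OS package + translations + proper
  hypercubic invariance + eight-frame RP + cone + the residual (i) + the growth (ii) ⇒ planar invariance
  (boosts inherit the mirrors: band limit + ray positivity on both half-lines + the landed parity sieve
  + doubled-orbit constancy ⇒ invariance, by induction on the level).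

`QCDBoostCovariance_of_subs : X₁ → X₂ → QCDBoostCovariance` (all three statements inline, verbatim
the bodies of the route decls; no route file imported, so the gate can link it as the glue of
`route edit --split QCDBoostCovariance` via `--glue-by`).  The seam is pure logic (unpack `W`, modus
ponens) — deliberately: the content sits in the two pieces, each with its own registered skeleton.
(A three-piece draft QCDTieRegularity / QCDLevelGrowth / LabelledBoostSieve was bounced by the route's
seven-crux cap; (i) ∧ (ii) is its honest merge.)  Strategist's file
(planner-cstrat-stmt-QuantumFields-9909-r1-0). [folklore]
-/

namespace Summit.QuantumFields.QCD.Theorems.TransparentRPWallQCDBoostCovarianceSplit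

/-- **THE SPLIT**: `QCDSieveInputs → LabelledBoostSieve → QCDBoostCovariance`
(the three statements inline, verbatim the bodies of the route decls of
`Summits/QuantumFields/QCD/Theses/TransparentRPWall.lean`). [folklore] -/
theorem QCDBoostCovariance_of_subs :
    (open Literature.MathematicalPhysics.QuantumLattice Literature.MathematicalPhysics.AQFT Literature.MathematicalPhysics.QuantumFieldTheory in let E := EuclideanSpace ℝ (Fin 4); let W := fun (Nf : ℕ) (sch : QCDScheme Nf) (S : LabelledSchwingerFamily (QCDField Nf) E) => ((S.IsNormalized ∧ S.IsHermitian ∧ S.HasLinearGrowth ∧ S.IsReflectionPositive ∧ S.IsSymmetric ∧ S.HasClusterProperty ∧ (∀ (n : ℕ) (k : Fin n → QCDField Nf) (a : E) (F : SchwartzMap (Fin n → E) ℂ), IsOffDiagonal F → S n k (translateMulti a F) = S n k F) ∧ (∀ (n : ℕ) (k : Fin n → QCDField Nf) (R : E ≃ₗᵢ[ℝ] E), LinearMap.det (R.toLinearEquiv : E →ₗ[ℝ] E) = 1 → (∀ i : Fin 4, ∃ j : Fin 4, R (EuclideanSpace.single i 1) = EuclideanSpace.single j 1 ∨ R (EuclideanSpace.single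 i 1) = -EuclideanSpace.single j 1) → ∀ F : SchwartzMap (Fin n → E) ℂ, IsOffDiagonal F → S n k (linActMulti R F) = S n k F)) ∧ (sch.HasAsymptoticScaling ∧ (∀ fl : Fin Nf, ∀ᶠ k in Filter.atTop, -1 < sch.mq fl k) ∧ (∀ (n : ℕ), n ≠ 0 → ∀ (σ : Fin n → QCDField Nf) (f : Fin n → SchwartzMap E ℝ) (F : SchwartzMap (Fin n → E) ℂ), IsTensorOf F (fun i => ofRealTest (f i)) → IsOffDiagonal F → Filter.Tendsto (fun k : ℕ => qcdLatticeSchwinger sch k n σ f) Filter.atTop (nhds (S n σ F)))) ∧ (∃ Δ : ℝ, 0 < Δ ∧ S.HasMassGap Δ ∧ sch.HasLatticeMassGap Δ)); ∀ (Nf : ℕ) (sch : QCDScheme Nf) (S : LabelledSchwingerFamily (QCDField Nf) E), W Nf sch S → (∀ (R : E ≃ₗᵢ[ℝ] E) (a b : ℝ), a ^ 2 + b ^ 2 = 1 → (a = 0 ∨ b = 0 ∨ a ^ 2 = b ^ 2) → R (EuclideanSpace.single 0 1) = a • EuclideanSpace.single 0 1 + b • EuclideanSpace.single 1 1 → LabelledSchwingerFamily.IsReflectionPositive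 (fun n (k : Fin n → QCDField Nf) => (S n k).comp (linActMulti R))) → (∀ (n m : ℕ) (k : Fin n → QCDField Nf) (k' : Fin m → QCDField Nf) (F : SchwartzMap (Fin n → E) ℂ) (G : SchwartzMap (Fin m → E) ℂ), IsTimeOrdered F → IsTimeOrdered G → ∃ Φ : ℂ × ℂ → ℂ, DifferentiableOn ℂ Φ {w : ℂ × ℂ | |w.2.im| < w.1.re} ∧ (∀ (t b : ℝ), 0 < t → ∀ H : SchwartzMap (Fin (n + m) → E) ℂ, IsAppendTensorOf H (osAdjoint F) (translateMulti (t • EuclideanSpace.single 0 1 + b • EuclideanSpace.single 1 1) G) → Φ ((t : ℂ), (b : ℂ)) = S (n + m) (Fin.append (k ∘ Fin.rev) k') H) ∧ (∀ w ∈ {w : ℂ × ℂ | |w.2.im| < w.1.re}, ∀ (HF : SchwartzMap (Fin (n + n) → E) ℂ) (HG : SchwartzMap (Fin (m + m) → E) ℂ), IsAppendTensorOf HF (osAdjoint F) F → IsAppendTensorOf HG (osAdjoint G) G → ‖Φ w‖ ^ 2 ≤ ‖S (n + n) (Fin.append (k ∘ Fin.rev) k) HF‖ * ‖S (m + m) (Fin.append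 (k' ∘ Fin.rev) k') HG‖)) → (∀ (n : ℕ) (k : Fin n → QCDField Nf), ∃ Wf : (Fin n → E) → ℂ, ∀ F : SchwartzMap (Fin n → E) ℂ, IsOffDiagonal F → MeasureTheory.Integrable (fun x : Fin n → E => Wf x * F x) ∧ S n k F = ∫ x : Fin n → E, Wf x * F x) ∧ (∀ a : ℕ, (∀ N : ℕ, N + 2 ≤ 2 * a → ∀ R : E ≃ₗᵢ[ℝ] E, LinearMap.det (R.toLinearEquiv : E →ₗ[ℝ] E) = 1 → R (EuclideanSpace.single 2 1) = EuclideanSpace.single 2 1 → R (EuclideanSpace.single 3 1) = EuclideanSpace.single 3 1 → ∀ (k : Fin N → QCDField Nf) (F : SchwartzMap (Fin N → E) ℂ), IsOffDiagonal F → S N k (linActMulti R F) = S N k F) → ∀ (k : Fin a → QCDField Nf) (F : SchwartzMap (Fin a → E) ℂ), IsTimeOrdered F → HasCompactSupport (F : (Fin a → E) → ℂ) → ∀ H : SchwartzMap (Fin (a + a) → E) ℂ, IsAppendTensorOf H (osAdjoint F) F → ∀ (K : ℕ) (p : ℤ → ℂ), (∀ θ : ℝ, S (a + a) (Fin.append (k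 ∘ Fin.rev) k) (linActMulti (planeRot (0 : Fin 3) θ) H) = ∑ j ∈ Finset.Icc (-(K : ℤ)) K, p j * Complex.exp (4 * (j : ℂ) * (θ : ℂ) * Complex.I)) → ∀ j ∈ Finset.Icc (-(K : ℤ)) K, 2 ≤ |j| → p j = 0)) →
    (open Literature.MathematicalPhysics.QuantumLattice Literature.MathematicalPhysics.AQFT Literature.MathematicalPhysics.QuantumFieldTheory in let E := EuclideanSpace ℝ (Fin 4); ∀ (ι : Type) (S : LabelledSchwingerFamily ι E), S.IsNormalized → S.IsHermitian → S.HasLinearGrowth → S.IsReflectionPositive → S.IsSymmetric → S.HasClusterProperty → (∀ (n : ℕ) (k : Fin n → ι) (a : E) (F : SchwartzMap (Fin n → E) ℂ), IsOffDiagonal F → S n k (translateMulti a F) = S n k F) → (∀ (n : ℕ) (k : Fin n → ι) (R : E ≃ₗᵢ[ℝ] E), LinearMap.det (R.toLinearEquiv : E →ₗ[ℝ] E) = 1 → (∀ i : Fin 4, ∃ j : Fin 4, R (EuclideanSpace.single i 1) = EuclideanSpace.single j 1 ∨ R (EuclideanSpace.single i 1) = -EuclideanSpace.single j 1) → ∀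 F : SchwartzMap (Fin n → E) ℂ, IsOffDiagonal F → S n k (linActMulti R F) = S n k F) → (∀ (R : E ≃ₗᵢ[ℝ] E) (a b : ℝ), a ^ 2 + b ^ 2 = 1 → (a = 0 ∨ b = 0 ∨ a ^ 2 = b ^ 2) → R (EuclideanSpace.single 0 1) = a • EuclideanSpace.single 0 1 + b • EuclideanSpace.single 1 1 → LabelledSchwingerFamily.IsReflectionPositive (fun n (k : Fin n → ι) => (S n k).comp (linActMulti R))) → (∀ (n m : ℕ) (k : Fin n → ι) (k' : Fin m → ι) (F : SchwartzMap (Fin n → E) ℂ) (G : SchwartzMap (Fin m → E) ℂ), IsTimeOrdered F → IsTimeOrdered G → ∃ Φ : ℂ × ℂ → ℂ, DifferentiableOn ℂ Φ {w : ℂ × ℂ | |w.2.im| < w.1.re} ∧ (∀ (t b : ℝ), 0 < t → ∀ H : SchwartzMap (Fin (n + m) → E) ℂ, IsAppendTensorOf H (osAdjoint F) (translateMulti (t • EuclideanSpace.single 0 1 + b • EuclideanSpace.single 1 1) G) → Φ ((t : ℂ), (b : ℂ)) = S (n + m) (Fin.append (k ∘ Fin.rev) k') H) ∧ (∀ w ∈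 {w : ℂ × ℂ | |w.2.im| < w.1.re}, ∀ (HF : SchwartzMap (Fin (n + n) → E) ℂ) (HG : SchwartzMap (Fin (m + m) → E) ℂ), IsAppendTensorOf HF (osAdjoint F) F → IsAppendTensorOf HG (osAdjoint G) G → ‖Φ w‖ ^ 2 ≤ ‖S (n + n) (Fin.append (k ∘ Fin.rev) k) HF‖ * ‖S (m + m) (Fin.append (k' ∘ Fin.rev) k') HG‖)) → (∀ (n : ℕ) (k : Fin n → ι), ∃ Wf : (Fin n → E) → ℂ, ∀ F : SchwartzMap (Fin n → E) ℂ, IsOffDiagonal F → MeasureTheory.Integrable (fun x : Fin n → E => Wf x * F x) ∧ S n k F = ∫ x : Fin n → E, Wf x * F x) → (∀ a : ℕ, (∀ N : ℕ, N + 2 ≤ 2 * a → ∀ R : E ≃ₗᵢ[ℝ] E, LinearMap.det (R.toLinearEquiv : E →ₗ[ℝ] E) = 1 → R (EuclideanSpace.single 2 1) = EuclideanSpace.single 2 1 → R (EuclideanSpace.single 3 1) = EuclideanSpace.single 3 1 → ∀ (k : Fin N → ι) (F : SchwartzMap (Fin N → E) ℂ), IsOffDiagonal F → S N k (linActMulti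 R F) = S N k F) → ∀ (k : Fin a → ι) (F : SchwartzMap (Fin a → E) ℂ), IsTimeOrdered F → HasCompactSupport (F : (Fin a → E) → ℂ) → ∀ H : SchwartzMap (Fin (a + a) → E) ℂ, IsAppendTensorOf H (osAdjoint F) F → ∀ (K : ℕ) (p : ℤ → ℂ), (∀ θ : ℝ, S (a + a) (Fin.append (k ∘ Fin.rev) k) (linActMulti (planeRot (0 : Fin 3) θ) H) = ∑ j ∈ Finset.Icc (-(K : ℤ)) K, p j * Complex.exp (4 * (j : ℂ) * (θ : ℂ) * Complex.I)) → ∀ j ∈ Finset.Icc (-(K : ℤ)) K, 2 ≤ |j| → p j = 0) → ∀ (R : E ≃ₗᵢ[ℝ] E), LinearMap.det (R.toLinearEquiv : E →ₗ[ℝ] E) = 1 → R (EuclideanSpace.single 2 1) = EuclideanSpace.single 2 1 → R (EuclideanSpace.single 3 1) = EuclideanSpace.single 3 1 → ∀ (n : ℕ) (k : Fin n → ι) (F : SchwartzMap (Fin n → E) ℂ), IsOffDiagonal F → S n k (linActMulti R F) = S n k F) →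
    (open Literature.MathematicalPhysics.QuantumLattice Literature.MathematicalPhysics.AQFT Literature.MathematicalPhysics.QuantumFieldTheory in let E := EuclideanSpace ℝ (Fin 4); let W := fun (Nf : ℕ) (sch : QCDScheme Nf) (S : LabelledSchwingerFamily (QCDField Nf) E) => ((S.IsNormalized ∧ S.IsHermitian ∧ S.HasLinearGrowth ∧ S.IsReflectionPositive ∧ S.IsSymmetric ∧ S.HasClusterProperty ∧ (∀ (n : ℕ) (k : Fin n → QCDField Nf) (a : E) (F : SchwartzMap (Fin n → E) ℂ), IsOffDiagonal F → S n k (translateMulti a F) = S n k F) ∧ (∀ (n : ℕ) (k : Fin n → QCDField Nf) (R : E ≃ₗᵢ[ℝ] E), LinearMap.det (R.toLinearEquiv : E →ₗ[ℝ] E) = 1 → (∀ i : Fin 4, ∃ j : Fin 4, R (EuclideanSpace.single i 1) = EuclideanSpace.single j 1 ∨ R (EuclideanSpace.single i 1) = -EuclideanSpace.single j 1) → ∀ F : SchwartzMap (Fin n → E) ℂ, IsOffDiagonal F → S n k (linActMulti R F) = S n k F)) ∧ (sch.HasAsymptoticScaling ∧ (∀ fl : Fin Nf, ∀ᶠ k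 in Filter.atTop, -1 < sch.mq fl k) ∧ (∀ (n : ℕ), n ≠ 0 → ∀ (σ : Fin n → QCDField Nf) (f : Fin n → SchwartzMap E ℝ) (F : SchwartzMap (Fin n → E) ℂ), IsTensorOf F (fun i => ofRealTest (f i)) → IsOffDiagonal F → Filter.Tendsto (fun k : ℕ => qcdLatticeSchwinger sch k n σ f) Filter.atTop (nhds (S n σ F)))) ∧ (∃ Δ : ℝ, 0 < Δ ∧ S.HasMassGap Δ ∧ sch.HasLatticeMassGap Δ)); ∀ (Nf : ℕ) (sch : QCDScheme Nf) (S : LabelledSchwingerFamily (QCDField Nf) E), W Nf sch S → (∀ (R : E ≃ₗᵢ[ℝ] E) (a b : ℝ), a ^ 2 + b ^ 2 = 1 → (a = 0 ∨ b = 0 ∨ a ^ 2 = b ^ 2) → R (EuclideanSpace.single 0 1) = a • EuclideanSpace.single 0 1 + b • EuclideanSpace.single 1 1 → LabelledSchwingerFamily.IsReflectionPositive (fun n (k : Fin n → QCDField Nf) => (S n k).comp (linActMulti R))) → (∀ (n m : ℕ) (k : Fin n → QCDField Nf) (k' : Fin m → QCDField Nf) (F : SchwartzMap (Fin n → E) ℂ)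 (G : SchwartzMap (Fin m → E) ℂ), IsTimeOrdered F → IsTimeOrdered G → ∃ Φ : ℂ × ℂ → ℂ, DifferentiableOn ℂ Φ {w : ℂ × ℂ | |w.2.im| < w.1.re} ∧ (∀ (t b : ℝ), 0 < t → ∀ H : SchwartzMap (Fin (n + m) → E) ℂ, IsAppendTensorOf H (osAdjoint F) (translateMulti (t • EuclideanSpace.single 0 1 + b • EuclideanSpace.single 1 1) G) → Φ ((t : ℂ), (b : ℂ)) = S (n + m) (Fin.append (k ∘ Fin.rev) k') H) ∧ (∀ w ∈ {w : ℂ × ℂ | |w.2.im| < w.1.re}, ∀ (HF : SchwartzMap (Fin (n + n) → E) ℂ) (HG : SchwartzMap (Fin (m + m) → E) ℂ), IsAppendTensorOf HF (osAdjoint F) F → IsAppendTensorOf HG (osAdjoint G) G → ‖Φ w‖ ^ 2 ≤ ‖S (n + n) (Fin.append (k ∘ Fin.rev) k) HF‖ * ‖S (m + m) (Fin.append (k' ∘ Fin.rev) k') HG‖)) → (∀ (R : E ≃ₗᵢ[ℝ] E), LinearMap.det (R.toLinearEquiv : E →ₗ[ℝ] E) = 1 → R (EuclideanSpace.single 2 1)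 = EuclideanSpace.single 2 1 → R (EuclideanSpace.single 3 1) = EuclideanSpace.single 3 1 → ∀ (n : ℕ) (k : Fin n → QCDField Nf) (F : SchwartzMap (Fin n → E) ℂ), IsOffDiagonal F → S n k (linActMulti R F) = S n k F)) := by
  intro h1 h2 E W Nf sch S hW h8 hcone
  have hWpkg := hW
  obtain ⟨⟨hnorm, hherm, hgrowth, hrp, hsymm, hclus, htr, hhyp⟩, -, -⟩ := hW
  obtain ⟨hreg, hgrow⟩ := h1 Nf sch S hWpkg h8 hcone
  exact h2 (Literature.MathematicalPhysics.QuantumFieldTheory.QCDField Nf) S hnorm hherm hgrowth hrp hsymm hclus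
    htr hhyp h8 hcone hreg hgrow

end Summit.QuantumFields.QCD.Theorems.TransparentRPWallQCDBoostCovarianceSplit
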